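import Mathlib
import HarnessLib
import Literature.Analysis.FluidPDE.VorticityCalculus
import Literature.Analysis.FluidPDE.BiotSavartNewtonKernel
import Summits.NavierStokesRegularity.NavierStokesRegularity.Theorems.TypeIQuarterGateScarEnvelopeTypeIForcedTsaiStokesletTail

/-!
# ARM B — EXACT PART OF DATUM B-2k: the STOKESLET's self-advection is not curl-free; its registered
  vorticity residual is `g_e(y) = −12 ⟪e,y⟫ (e × y)/|y|⁶` (ns-wall-extremal, eng-1 lineage g5, 2026-08-29)

WHAT IS PROVED (theorem-only; explicit fields; standard axioms).  With the Stokeslet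
`U_e(y) := (‖y‖²)^{−1/2} • e + ((‖y‖²)^{−3/2}⟪e,y⟫) • y` of `…ForcedTsaiStokesletTail` (p691545) and
`x ≠ 0`:
* `hasFDerivAt_stokeslet` : the derivative `DU_e(x)` as an explicit continuous linear map;
* ★ `convect_stokeslet` : `(U_e·∇)U_e (x) = (‖e‖²/‖x‖⁴ − 4⟪e,x⟫²/‖x‖⁶) x − (⟪e,x⟫/‖x‖⁴) e`
  (`convect_stokeslet_rpow`: the same in radial powers `(‖x‖²)^{−2}`, `(‖x‖²)^{−3}`);
* ★ `curl_convect_stokeslet` : `curl((U_e·∇)U_e)(x) = −12 ⟪e,x⟫ (‖x‖²)^{−3} (e × x)` — via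
  `curl_selfAdvectionField`, the curl of the explicit field above (`curl (a y) = ∇a × y`,
  `curl (b e) = ∇b × e`, gradients read off explicit derivatives);
* `curl_gradient_eq_zero_of_contDiffAt` : a LOCAL `curl ∇θ (x) = 0` for `θ` merely `C²` at `x`
  (the tree's `curl_gradient_eq_zero_holds` wants global `C²`; the Stokeslet pressure is singular at `0`);
* ★★ `lerayVorticityResidual_stokeslet` : the REGISTERED vorticity residual of `…ForcedTsaiDefs`
  (`g = curl(−ΔU + ½U + ½DU·y + (U·∇)U)`) of the Stokeslet is
  `g_e(x) = −12 ⟪e,x⟫ (‖x‖²)^{−3} (e × x)` exactly: the linear part is `−∇P_e` (p691545) and drops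
  under the curl, what is left is the curl of the self-advection;
  `lerayVorticityResidual_stokeslet_eq_zero_iff` : it vanishes exactly on the axis `ℝe` and the
  plane `e^⊥`.

MEANING (HOME/ARM-B/secondorder-eng1g5/SECOND-ORDER.md §3, DATUM B-2k): the far field of the linear
floor mode of DATUM B-2j is `(c/2)·U_e`; at NONLINEAR order it carries the residual density
`(c²/4) g_e ~ 3c² |y|⁻⁴`, whose registered weight `(1+|y|)⁵|g|²` is not integrable at infinity
(`∫ dr/r`) — the Stokeslet tail is admissible at linear order only, every LANEX row needs its `r⁻³`
closure, and `R(εU₁) = ∞` for every `ε ≠ 0` (the non-integrability itself is not formalised here).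
HONEST FRAME: pointwise identities for explicit fields; nothing about the wall H3, crux
`ScarEnvelopeTypeI` (stmt-23843, OPEN) or Navier–Stokes regularity (NOT proved).
-/

noncomputable section

set_option linter.dupNamespace false

namespace Summit.NavierStokesRegularity.NavierStokesRegularity.Cruxes.ScarEnvelopeTypeI.ForcedTsai

open scoped Laplacian RealInnerProductSpace InnerProductSpace
open Literature.Analysis.FluidPDE Set Filter Topology

/-! ## Derivatives of the radial powers `(‖y‖²)^p` and of the Stokeslet -/

/-- `D[(‖y‖²)^p](x) = 2p (‖x‖²)^{p-1} ⟪x, ·⟫` off the origin. -/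
theorem hasFDerivAt_norm_sq_rpow (p : ℝ) {x : E3} (hx : x ≠ 0) :
    HasFDerivAt (fun y : E3 => (‖y‖ ^ 2) ^ p) ((2 * p * (‖x‖ ^ 2) ^ (p - 1)) • innerSL ℝ x) x := by
  have hσ : (‖x‖ ^ 2 : ℝ) ≠ 0 := by positivity
  have h := (hasStrictFDerivAt_norm_sq x).hasFDerivAt.rpow_const (p := p) (Or.inl hσ)
  refine h.congr_fderiv ?_
  ext v
  simp only [smul_apply, smul_eq_mul, innerSL_apply_apply, two_smul, add_apply]
  ring

/-- The derivative of the Stokeslet `U_e(y) = (‖y‖²)^{-1/2} • e + ((‖y‖²)^{-3/2}⟪e,y⟫) • y` off the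
origin, as an explicit continuous linear map. -/
theorem hasFDerivAt_stokeslet (e : E3) {x : E3} (hx : x ≠ 0) :
    HasFDerivAt (fun y : E3 => (‖y‖ ^ 2) ^ (-(1 : ℝ) / 2) • e + ((‖y‖ ^ 2) ^ (-(3 : ℝ) / 2) * ⟪e, y⟫) • y)
      (((2 * (-(1 : ℝ) / 2) * (‖x‖ ^ 2) ^ (-(1 : ℝ) / 2 - 1)) • innerSL ℝ x).smulRight e
        + (((‖x‖ ^ 2) ^ (-(3 : ℝ) / 2) * ⟪e, x⟫) • ContinuousLinearMap.id ℝ E3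
          + ((‖x‖ ^ 2) ^ (-(3 : ℝ) / 2) • innerSL ℝ e
              + ⟪e, x⟫ • ((2 * (-(3 : ℝ) / 2) * (‖x‖ ^ 2) ^ (-(3 : ℝ) / 2 - 1)) • innerSL ℝ x)).smulRight x))
      x := by
  have h1 := (hasFDerivAt_norm_sq_rpow (-(1 : ℝ) / 2) hx).smul_const e
  have hψ : HasFDerivAt (fun y : E3 => ⟪e, y⟫) (innerSL ℝ e) x := (innerSL ℝ e).hasFDerivAt
  have h3 := ((hasFDerivAt_norm_sq_rpow (-(3 : ℝ) / 2) hx).mul hψ).smul (hasFDerivAt_id x)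
  exact h1.add h3

/-- Conversion of the radial powers to inverse powers of `‖x‖`: `(‖x‖²)^q = (‖x‖⁻¹)^k` when
`-2q = k`. -/
theorem norm_sq_rpow_eq_inv_pow {x : E3} (hx : x ≠ 0) {q : ℝ} {k : ℕ} (h : -2 * q = k) :
    (‖x‖ ^ 2) ^ q = (‖x‖⁻¹) ^ k := by
  have hr : 0 < ‖x‖ := norm_pos_iff.mpr hx
  rw [show (‖x‖ ^ 2 : ℝ) = ‖x‖ ^ (2 : ℝ) by norm_cast, ← Real.rpow_mul hr.le,
    show (2 : ℝ) * q = -(k : ℝ) by linarith, Real.rpow_neg hr.le, Real.rpow_natCast, inv_pow]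

/-- ★ **Self-advection of the Stokeslet** (`x ≠ 0`):
`(U_e·∇)U_e (x) = (‖e‖²/‖x‖⁴ − 4⟪e,x⟫²/‖x‖⁶) x − (⟪e,x⟫/‖x‖⁴) e`. -/
theorem convect_stokeslet (e : E3) {x : E3} (hx : x ≠ 0) :
    convect (fun y : E3 => (‖y‖ ^ 2) ^ (-(1 : ℝ) / 2) • e + ((‖y‖ ^ 2) ^ (-(3 : ℝ) / 2) * ⟪e, y⟫) • y)
        (fun y : E3 => (‖y‖ ^ 2) ^ (-(1 : ℝ) / 2) • e + ((‖y‖ ^ 2) ^ (-(3 : ℝ) / 2) * ⟪e, y⟫) • y) x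
      = (‖e‖ ^ 2 / ‖x‖ ^ 4 - 4 * ⟪e, x⟫ ^ 2 / ‖x‖ ^ 6) • x - (⟪e, x⟫ / ‖x‖ ^ 4) • e := by
  have hr : ‖x‖ ≠ 0 := norm_ne_zero_iff.mpr hx
  rw [convect, (hasFDerivAt_stokeslet e hx).fderiv]
  have e1 : (‖x‖ ^ 2) ^ (-(1 : ℝ) / 2) = (‖x‖⁻¹) ^ 1 := norm_sq_rpow_eq_inv_pow hx (by norm_num)
  have e3 : (‖x‖ ^ 2) ^ (-(3 : ℝ) / 2) = (‖x‖⁻¹) ^ 3 := norm_sq_rpow_eq_inv_pow hx (by norm_num)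
  have e3' : (‖x‖ ^ 2) ^ (-(1 : ℝ) / 2 - 1) = (‖x‖⁻¹) ^ 3 := norm_sq_rpow_eq_inv_pow hx (by norm_num)
  have e5 : (‖x‖ ^ 2) ^ (-(3 : ℝ) / 2 - 1) = (‖x‖⁻¹) ^ 5 := norm_sq_rpow_eq_inv_pow hx (by norm_num)
  simp only [add_apply, ContinuousLinearMap.smulRight_apply, smul_apply,
    ContinuousLinearMap.id_apply, innerSL_apply_apply, inner_add_right, inner_smul_right,
    real_inner_self_eq_norm_sq, real_inner_comm x e, smul_eq_mul, e1, e3, e3', e5, pow_one]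
  match_scalars <;> field_simp <;> ring


/-- The self-advection in radial-power form (the shape used for differentiation below):
`(U_e·∇)U_e (x) = (‖e‖²(‖x‖²)^{-2} − 4⟪e,x⟫²(‖x‖²)^{-3}) x − (⟪e,x⟫(‖x‖²)^{-2}) e`. -/
theorem convect_stokeslet_rpow (e : E3) {x : E3} (hx : x ≠ 0) :
    convect (fun y : E3 => (‖y‖ ^ 2) ^ (-(1 : ℝ) / 2) • e + ((‖y‖ ^ 2) ^ (-(3 : ℝ) / 2) * ⟪e, y⟫) • y)
        (fun y : E3 => (‖y‖ ^ 2) ^ (-(1 : ℝ) / 2) • e + ((‖y‖ ^ 2) ^ (-(3 : ℝ) / 2) * ⟪e, y⟫) • y) x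
      = (‖e‖ ^ 2 * (‖x‖ ^ 2) ^ (-(2 : ℝ)) - 4 * ⟪e, x⟫ ^ 2 * (‖x‖ ^ 2) ^ (-(3 : ℝ))) • x
        - (⟪e, x⟫ * (‖x‖ ^ 2) ^ (-(2 : ℝ))) • e := by
  have hr : ‖x‖ ≠ 0 := norm_ne_zero_iff.mpr hx
  have e4 : (‖x‖ ^ 2) ^ (-(2 : ℝ)) = (‖x‖⁻¹) ^ 4 := norm_sq_rpow_eq_inv_pow hx (by norm_num)
  have e6 : (‖x‖ ^ 2) ^ (-(3 : ℝ)) = (‖x‖⁻¹) ^ 6 := norm_sq_rpow_eq_inv_pow hx (by norm_num)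
  rw [convect_stokeslet e hx, e4, e6]
  match_scalars <;> field_simp

/-! ## The curl of the self-advection field -/

/-- `Dg(x) = ⟪∇g(x), ·⟫` (Riesz). -/
theorem fderiv_eq_innerSL_gradient' (g : E3 → ℝ) (x : E3) :
    fderiv ℝ g x = innerSL ℝ (gradient g x) := by
  ext v
  rw [innerSL_apply_apply, gradient, InnerProductSpace.toDual_symm_apply]

/-- The gradient read off an explicit derivative `Dg(x) = ⟪w, ·⟫`. -/
theorem gradient_eq_of_hasFDerivAt_innerSL {g : E3 → ℝ} {x w : E3}
    (h : HasFDerivAt g (innerSL ℝ w) x) : gradient g x = w := by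
  have h' : HasGradientAt g w x := by
    rw [hasGradientAt_iff_hasFDerivAt]
    refine h.congr_fderiv ?_
    ext v
    rw [InnerProductSpace.toDual_apply_apply, innerSL_apply_apply]
  exact h'.gradient

/-- `curl` of the identity field vanishes. -/
theorem curl_id_eq_zero (x : E3) : curl (fun y : E3 => y) x = 0 := by
  rw [curl_eq_curlCLM, fderiv_fun_id]
  rw [curlCLM]
  simp only [LinearMap.coe_toContinuousLinearMap']
  rw [curlLM]
  ext i
  fin_cases i <;> simp

/-- `curl (g • id)(x) = ∇g(x) × x` for a scalar `g` differentiable at `x`. -/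
theorem curl_smul_id {g : E3 → ℝ} {x : E3} (hg : DifferentiableAt ℝ g x) :
    curl (fun y : E3 => g y • y) x = cross (gradient g x) x := by
  rw [curl_smul (f := fun y : E3 => y) hg differentiableAt_id, curl_id_eq_zero, smul_zero, zero_add,
    fderiv_eq_innerSL_gradient', curlCLM_smulRight_innerSL]

/-- `curl (g • e)(x) = ∇g(x) × e` for a constant vector `e` and a scalar `g` differentiable at `x`. -/
theorem curl_smul_const' {g : E3 → ℝ} {x : E3} (hg : DifferentiableAt ℝ g x) (v : E3) :
    curl (fun y : E3 => g y • v) x = cross (gradient g x) v := by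
  rw [curl_smul hg (differentiableAt_const v), curl_eq_zero_of_fderiv_eq_zero (by simp),
    smul_zero, zero_add, fderiv_eq_innerSL_gradient', curlCLM_smulRight_innerSL]

/-- Left linearity of the cross product in the form used below. -/
theorem cross_add_smul_left (a b : ℝ) (u v w : E3) :
    cross (a • u + b • v) w = a • cross u w + b • cross v w := by
  rw [← crossCLM_apply, map_add, map_smul, map_smul]
  rfl

/-- The coefficient `a(y) = ‖e‖²(‖y‖²)^{-2} − 4⟪e,y⟫²(‖y‖²)^{-3}` of `y` in `(U_e·∇)U_e`: its gradient
off the origin (written `⟪α x + β e, ·⟫`). -/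
theorem hasFDerivAt_selfAdvection_coeffA (e : E3) {x : E3} (hx : x ≠ 0) :
    HasFDerivAt (fun y : E3 => ‖e‖ ^ 2 * (‖y‖ ^ 2) ^ (-(2 : ℝ)) - 4 * ⟪e, y⟫ ^ 2 * (‖y‖ ^ 2) ^ (-(3 : ℝ)))
      (innerSL ℝ ((‖e‖ ^ 2 * (2 * (-(2 : ℝ)) * (‖x‖ ^ 2) ^ (-(2 : ℝ) - 1))
            - 4 * ⟪e, x⟫ ^ 2 * (2 * (-(3 : ℝ)) * (‖x‖ ^ 2) ^ (-(3 : ℝ) - 1))) • x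
          + (-(4 * (2 * ⟪e, x⟫) * (‖x‖ ^ 2) ^ (-(3 : ℝ)))) • e)) x := by
  have hψ : HasFDerivAt (fun y : E3 => ⟪e, y⟫) (innerSL ℝ e) x := (innerSL ℝ e).hasFDerivAt
  have hA := (hasFDerivAt_norm_sq_rpow (-(2 : ℝ)) hx).const_mul (‖e‖ ^ 2)
  have hB := ((hψ.pow 2).const_mul (4 : ℝ)).mul (hasFDerivAt_norm_sq_rpow (-(3 : ℝ)) hx)
  refine (hA.sub hB).congr_fderiv ?_
  ext v
  simp only [sub_apply, add_apply, smul_apply, innerSL_apply_apply, smul_eq_mul, inner_add_left,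
    inner_smul_left, conj_trivial, nsmul_eq_mul, Nat.cast_ofNat, pow_one, Nat.add_one_sub_one]
  ring

/-- The coefficient `b(y) = ⟪e,y⟫(‖y‖²)^{-2}` of `e` in `(U_e·∇)U_e`: its gradient off the origin. -/
theorem hasFDerivAt_selfAdvection_coeffB (e : E3) {x : E3} (hx : x ≠ 0) :
    HasFDerivAt (fun y : E3 => ⟪e, y⟫ * (‖y‖ ^ 2) ^ (-(2 : ℝ)))
      (innerSL ℝ ((⟪e, x⟫ * (2 * (-(2 : ℝ)) * (‖x‖ ^ 2) ^ (-(2 : ℝ) - 1))) • x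
          + ((‖x‖ ^ 2) ^ (-(2 : ℝ))) • e)) x := by
  have hψ : HasFDerivAt (fun y : E3 => ⟪e, y⟫) (innerSL ℝ e) x := (innerSL ℝ e).hasFDerivAt
  have hB := hψ.mul (hasFDerivAt_norm_sq_rpow (-(2 : ℝ)) hx)
  refine hB.congr_fderiv ?_
  ext v
  simp only [add_apply, smul_apply, innerSL_apply_apply, smul_eq_mul, inner_add_left,
    inner_smul_left, conj_trivial]
  ring

/-- **Curl of the self-advection field**: for `x ≠ 0`,
`curl[(‖e‖²(‖y‖²)^{-2} − 4⟪e,y⟫²(‖y‖²)^{-3}) y − (⟪e,y⟫(‖y‖²)^{-2}) e](x) = −12⟪e,x⟫(‖x‖²)^{-3} (e × x)`. -/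
theorem curl_selfAdvectionField (e : E3) {x : E3} (hx : x ≠ 0) :
    curl (fun y : E3 => (‖e‖ ^ 2 * (‖y‖ ^ 2) ^ (-(2 : ℝ)) - 4 * ⟪e, y⟫ ^ 2 * (‖y‖ ^ 2) ^ (-(3 : ℝ))) • y
        - (⟪e, y⟫ * (‖y‖ ^ 2) ^ (-(2 : ℝ))) • e) x
      = (-12 * ⟪e, x⟫ * (‖x‖ ^ 2) ^ (-(3 : ℝ))) • cross e x := by
  have hr : ‖x‖ ≠ 0 := norm_ne_zero_iff.mpr hx
  have hA := hasFDerivAt_selfAdvection_coeffA e hx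
  have hB := hasFDerivAt_selfAdvection_coeffB e hx
  have hdA : DifferentiableAt ℝ (fun y : E3 =>
      (‖e‖ ^ 2 * (‖y‖ ^ 2) ^ (-(2 : ℝ)) - 4 * ⟪e, y⟫ ^ 2 * (‖y‖ ^ 2) ^ (-(3 : ℝ))) • y) x :=
    hA.differentiableAt.smul differentiableAt_id
  have hdB : DifferentiableAt ℝ (fun y : E3 => (⟪e, y⟫ * (‖y‖ ^ 2) ^ (-(2 : ℝ))) • e) x :=
    hB.differentiableAt.smul (differentiableAt_const e)
  -- `v × v = 0` (Mathlib's `cross_self`, transported; cf. the tree's `PointSource.cross_self`)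
  have hxx : cross x x = 0 := by simp [cross]
  have hee : cross e e = 0 := by simp [cross]
  rw [curl_sub hdA hdB, curl_smul_id hA.differentiableAt, curl_smul_const' hB.differentiableAt e,
    gradient_eq_of_hasFDerivAt_innerSL hA, gradient_eq_of_hasFDerivAt_innerSL hB,
    cross_add_smul_left, cross_add_smul_left, hxx, hee, cross_swap x e, smul_zero,
    zero_add, smul_zero, add_zero]
  have e6 : (‖x‖ ^ 2) ^ (-(3 : ℝ)) = (‖x‖⁻¹) ^ 6 := norm_sq_rpow_eq_inv_pow hx (by norm_num)
  have e6' : (‖x‖ ^ 2) ^ (-(2 : ℝ) - 1) = (‖x‖⁻¹) ^ 6 := norm_sq_rpow_eq_inv_pow hx (by norm_num)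
  rw [e6, e6']
  match_scalars
  field_simp
  ring

/-- ★ **The vorticity source of the Stokeslet's self-advection**: for `x ≠ 0`,
`curl((U_e·∇)U_e)(x) = −12 ⟪e,x⟫ (‖x‖²)^{-3} (e × x)` — not identically zero, so `(U_e·∇)U_e` is
NOT a gradient and the Stokeslet solves the linearised (p691545) but not the full steady system. -/
theorem curl_convect_stokeslet (e : E3) {x : E3} (hx : x ≠ 0) :
    curl (convect
        (fun y : E3 => (‖y‖ ^ 2) ^ (-(1 : ℝ) / 2) • e + ((‖y‖ ^ 2) ^ (-(3 : ℝ) / 2) * ⟪e, y⟫) • y)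
        (fun y : E3 => (‖y‖ ^ 2) ^ (-(1 : ℝ) / 2) • e + ((‖y‖ ^ 2) ^ (-(3 : ℝ) / 2) * ⟪e, y⟫) • y)) x
      = (-12 * ⟪e, x⟫ * (‖x‖ ^ 2) ^ (-(3 : ℝ))) • cross e x := by
  have hne : ∀ᶠ y in 𝓝 x, y ≠ (0 : E3) := eventually_ne_nhds hx
  have hconv : convect
        (fun y : E3 => (‖y‖ ^ 2) ^ (-(1 : ℝ) / 2) • e + ((‖y‖ ^ 2) ^ (-(3 : ℝ) / 2) * ⟪e, y⟫) • y)
        (fun y : E3 => (‖y‖ ^ 2) ^ (-(1 : ℝ) / 2) • e + ((‖y‖ ^ 2) ^ (-(3 : ℝ) / 2) * ⟪e, y⟫) • y)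
      =ᶠ[𝓝 x] fun y : E3 =>
        (‖e‖ ^ 2 * (‖y‖ ^ 2) ^ (-(2 : ℝ)) - 4 * ⟪e, y⟫ ^ 2 * (‖y‖ ^ 2) ^ (-(3 : ℝ))) • y
          - (⟪e, y⟫ * (‖y‖ ^ 2) ^ (-(2 : ℝ))) • e :=
    hne.mono fun y hy => convect_stokeslet_rpow e hy
  rw [curl_eq_curlCLM, hconv.fderiv_eq, ← curl_eq_curlCLM, curl_selfAdvectionField e hx]

/-! ## A local `curl ∇ = 0` and the registered vorticity residual of the Stokeslet -/

/-- Local version of the tree's `fderiv_gradient_single_apply`: if the Hessian exists at `x`, the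
gradient field is differentiable at `x` and its Jacobian entries are the second derivatives. -/
theorem differentiableAt_gradient_of_hasFDerivAt {θ : E3 → ℝ} {x : E3}
    {D2 : E3 →L[ℝ] E3 →L[ℝ] ℝ} (hD : HasFDerivAt (fderiv ℝ θ) D2 x) :
    DifferentiableAt ℝ (gradient θ) x ∧ ∀ i j : Fin 3,
      fderiv ℝ (gradient θ) x (EuclideanSpace.single j 1) i =
        D2 (EuclideanSpace.single j 1) (EuclideanSpace.single i 1) := by
  set b : Fin 3 → E3 := fun k => EuclideanSpace.single k 1 with hb
  have hcoord : ∀ k, (fun y => gradient θ y k) = fun y => fderiv ℝ θ y (b k) := by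
    intro k
    funext y
    have h1 : ⟪gradient θ y, b k⟫ = gradient θ y k := by
      simp only [hb, EuclideanSpace.inner_single_right, one_mul, RCLike.conj_to_real]
    rw [← h1, gradient, InnerProductSpace.toDual_symm_apply]
  have hk : ∀ k, HasFDerivAt (fun y => gradient θ y k)
      ((ContinuousLinearMap.apply ℝ ℝ (b k)).comp D2) x := by
    intro k
    rw [hcoord k]
    exact (ContinuousLinearMap.apply ℝ ℝ (b k)).hasFDerivAt.comp x hD
  have hg : DifferentiableAt ℝ (gradient θ) x :=
    differentiableAt_euclidean.2 fun k => (hk k).differentiableAt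
  refine ⟨hg, fun i j => ?_⟩
  have hproj : HasFDerivAt (⇑(PiLp.proj 2 (fun _ : Fin 3 => ℝ) i) ∘ gradient θ)
      ((PiLp.proj 2 (fun _ : Fin 3 => ℝ) i).comp (fderiv ℝ (gradient θ) x)) x :=
    (PiLp.proj 2 (fun _ : Fin 3 => ℝ) i).hasFDerivAt.comp x hg.hasFDerivAt
  have huniq := hproj.unique (hk i)
  have := congrArg (fun L : E3 →L[ℝ] ℝ => L (b j)) huniq
  simpa using this

/-- **Local `curl ∇θ = 0`**: if `θ` is `C²` at `x` then `∇θ` is differentiable at `x` and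
`curl (∇θ)(x) = 0` (symmetry of the second derivative, Mathlib's `ContDiffAt.isSymmSndFDerivAt`;
the tree's `curl_gradient_eq_zero_holds` assumes global `C²`). -/
theorem curl_gradient_eq_zero_of_contDiffAt {θ : E3 → ℝ} {x : E3} (hθ : ContDiffAt ℝ 2 θ x) :
    DifferentiableAt ℝ (gradient θ) x ∧ curl (gradient θ) x = 0 := by
  have hD : HasFDerivAt (fderiv ℝ θ) (fderiv ℝ (fderiv ℝ θ) x) x :=
    ((hθ.fderiv_right (m := 1) (by norm_num)).differentiableAt (by norm_num)).hasFDerivAt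
  obtain ⟨hg, hS⟩ := differentiableAt_gradient_of_hasFDerivAt hD
  have hsymm : IsSymmSndFDerivAt ℝ θ x := hθ.isSymmSndFDerivAt (by simp)
  have hS' : ∀ i j : Fin 3, fderiv ℝ (gradient θ) x (EuclideanSpace.single j 1) i =
      fderiv ℝ (gradient θ) x (EuclideanSpace.single i 1) j := by
    intro i j
    rw [hS i j, hS j i, hsymm.eq]
  refine ⟨hg, ?_⟩
  simp only [curl]
  rw [hS' 2 1, hS' 0 2, hS' 1 0, sub_self, sub_self, sub_self]
  ext k
  fin_cases k <;> simp

/-- ★★ **The registered vorticity residual of the Stokeslet** (`…ForcedTsaiDefs`,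
`lerayVorticityResidual U = curl(−ΔU + ½U + ½DU·y + (U·∇)U)`): for `x ≠ 0`,
`g_e(x) = −12 ⟪e,x⟫ (‖x‖²)^{-3} (e × x)`.  The linear part is `−∇P_e` by p691545
(`stokeslet_linearisedLerayProfile`) and has zero curl; what is left is the curl of the
self-advection.  So the exact Stokeslet tail has residual density `|g_e| ≍ |y|^{-4}`: it is an
admissible tail of the registered currency `‖(1+|y|)^{5/2} g‖_{L²}` at LINEAR order only. -/
theorem lerayVorticityResidual_stokeslet (e : E3) {x : E3} (hx : x ≠ 0) :
    lerayVorticityResidual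
        (fun y : E3 => (‖y‖ ^ 2) ^ (-(1 : ℝ) / 2) • e + ((‖y‖ ^ 2) ^ (-(3 : ℝ) / 2) * ⟪e, y⟫) • y) x
      = (-12 * ⟪e, x⟫ * (‖x‖ ^ 2) ^ (-(3 : ℝ))) • cross e x := by
  set U : E3 → E3 :=
    fun y : E3 => (‖y‖ ^ 2) ^ (-(1 : ℝ) / 2) • e + ((‖y‖ ^ 2) ^ (-(3 : ℝ) / 2) * ⟪e, y⟫) • y with hU
  set P : E3 → ℝ := fun y : E3 => 2 * ((‖y‖ ^ 2) ^ (-(3 : ℝ) / 2) * ⟪e, y⟫) with hP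
  have hne : ∀ᶠ y in 𝓝 x, y ≠ (0 : E3) := eventually_ne_nhds hx
  -- the momentum residual is `(U·∇)U − ∇P` off the origin
  have hres : lerayMomentumResidual U =ᶠ[𝓝 x] fun y => convect U U y - gradient P y := by
    refine hne.mono fun y hy => ?_
    have h := stokeslet_linearisedLerayProfile e hy
    rw [← hU, ← hP] at h
    have hlin : -((Δ U) y) + (1 / 2 : ℝ) • U y + (1 / 2 : ℝ) • fderiv ℝ U y y = -gradient P y :=
      eq_neg_of_add_eq_zero_left h
    rw [lerayMomentumResidual, hlin, neg_add_eq_sub]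
  -- the self-advection agrees near `x` with the explicit field
  have hconv : convect U U =ᶠ[𝓝 x] fun y : E3 =>
      (‖e‖ ^ 2 * (‖y‖ ^ 2) ^ (-(2 : ℝ)) - 4 * ⟪e, y⟫ ^ 2 * (‖y‖ ^ 2) ^ (-(3 : ℝ))) • y
        - (⟪e, y⟫ * (‖y‖ ^ 2) ^ (-(2 : ℝ))) • e :=
    hne.mono fun y hy => by rw [hU]; exact convect_stokeslet_rpow e hy
  have hdG : DifferentiableAt ℝ (fun y : E3 =>
      (‖e‖ ^ 2 * (‖y‖ ^ 2) ^ (-(2 : ℝ)) - 4 * ⟪e, y⟫ ^ 2 * (‖y‖ ^ 2) ^ (-(3 : ℝ))) • y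
        - (⟪e, y⟫ * (‖y‖ ^ 2) ^ (-(2 : ℝ))) • e) x :=
    ((hasFDerivAt_selfAdvection_coeffA e hx).differentiableAt.smul differentiableAt_id).sub
      ((hasFDerivAt_selfAdvection_coeffB e hx).differentiableAt.smul (differentiableAt_const e))
  have hdc : DifferentiableAt ℝ (convect U U) x := hconv.differentiableAt_iff.mpr hdG
  -- the pressure is `C²` at `x`, so `∇P` is differentiable there with zero curl
  have hPc : ContDiffAt ℝ 2 P x := contDiffAt_const.mul (contDiffAt_dipolePotential e hx)
  obtain ⟨hdP, hcurlP⟩ := curl_gradient_eq_zero_of_contDiffAt hPc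
  rw [lerayVorticityResidual, curl_eq_curlCLM, hres.fderiv_eq, ← curl_eq_curlCLM, curl_sub hdc hdP,
    hcurlP, sub_zero, curl_eq_curlCLM, hconv.fderiv_eq, ← curl_eq_curlCLM,
    curl_selfAdvectionField e hx]

/-- The Stokeslet's registered residual vanishes exactly on the axis `ℝe` and on the equatorial
plane `e^⊥` (off the origin). -/
theorem lerayVorticityResidual_stokeslet_eq_zero_iff (e : E3) {x : E3} (hx : x ≠ 0) :
    lerayVorticityResidual
        (fun y : E3 => (‖y‖ ^ 2) ^ (-(1 : ℝ) / 2) • e + ((‖y‖ ^ 2) ^ (-(3 : ℝ) / 2) * ⟪e, y⟫) • y) x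
        = 0 ↔ ⟪e, x⟫ = 0 ∨ cross e x = 0 := by
  have hσ : 0 < (‖x‖ ^ 2) ^ (-(3 : ℝ)) := Real.rpow_pos_of_pos (by positivity) _
  rw [lerayVorticityResidual_stokeslet e hx, smul_eq_zero]
  constructor
  · rintro (h | h)
    · left
      have : (-12 : ℝ) * (‖x‖ ^ 2) ^ (-(3 : ℝ)) ≠ 0 := by
        have : (12 : ℝ) * (‖x‖ ^ 2) ^ (-(3 : ℝ)) ≠ 0 := by positivity
        simpa using this
      have h' : (-12 : ℝ) * (‖x‖ ^ 2) ^ (-(3 : ℝ)) * ⟪e, x⟫ = 0 := by linear_combination h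
      exact (mul_eq_zero.mp h').resolve_left this
    · exact Or.inr h
  · rintro (h | h)
    · left; rw [h]; ring
    · exact Or.inr h

end Summit.NavierStokesRegularity.NavierStokesRegularity.Cruxes.ScarEnvelopeTypeI.ForcedTsai

end
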